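import Mathlib.MeasureTheory.Measure.Haar.Unique
import HarnessLib

/-!
# A right-invariant measure, finite on compacts and non-zero, is a Haar measure — on a group that
# carries a two-sided Haar measure

Topic `MeasureTheory/Group`; namespace `Literature.MeasureTheory.Group`. THEOREMS ONLY (no definition, no
instance visible to importers, no notation, no named fact, no `sorry`); Mathlib-only imports. On a locally
compact second countable group `G` with a Haar measure `νi` that is ALSO right invariant (so `G` is
unimodular), every RIGHT-invariant Borel measure `μ` finite on compact sets is a scalar multiple of `νi`,
and is itself a (left) Haar measure as soon as `μ ≠ 0` ([Folland1999] Thm 11.9 with Prop 11.4 / (2.32):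
uniqueness of Haar measure, `μ ↦ μ̌` exchanges left and right Haar measures; [Halmos1950] §60 Thm C). Route:
`μ.inv` and `νi.inv` are left invariant and finite on compacts (Mathlib instances), so both are multiples of
`νi` by Mathlib `MeasureTheory.Measure.isMulLeftInvariant_eq_smul`; invert back with `Measure.inv_inv`.

* **`exists_nnreal_smul_eq_of_isMulRightInvariant_of_ne_zero`** — `∃ κ : ℝ≥0, κ ≠ 0 ∧ μ = κ • νi`;
* **`isHaarMeasure_of_isMulRightInvariant_of_ne_zero`** — `μ.IsHaarMeasure`
  (Mathlib `IsHaarMeasure.smul`).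

Cell `hodgecm-mathlib`, ENGINE T1 (c4) head (F0P3a-plan (g5) 09:06:35Z (RH) SPEC): the archimedean measure
`νGi` of the frozen T1 head is bound only as `[IsFiniteMeasureOnCompacts νGi] [νGi.IsMulRightInvariant]`;
this leaf upgrades it to a Haar measure once it is known to be non-zero. HC_CM is proved only modulo the 7
printed citations until rung 0 closes — nothing here bears on a summit statement.

## References
* [Folland1999] G. B. Folland, *Real Analysis*, 2nd ed. (1999), Prop 11.4, Thm 11.9 (left/right Haar
  measures and uniqueness).
* [Halmos1950] P. R. Halmos, *Measure Theory* (1950), §60 Theorem C (uniqueness of Haar measure).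
-/

set_option autoImplicit false

noncomputable section

open MeasureTheory MeasureTheory.Measure
open scoped ENNReal NNReal

namespace Literature.MeasureTheory.Group

variable {G : Type*} [Group G] [TopologicalSpace G] [IsTopologicalGroup G] [LocallyCompactSpace G]
  [SecondCountableTopology G] [MeasurableSpace G] [BorelSpace G]

omit [TopologicalSpace G] [IsTopologicalGroup G] [LocallyCompactSpace G] [SecondCountableTopology G]
  [BorelSpace G] in
/-- Inversion commutes with `ℝ≥0`-scalar multiplication of measures: `(κ • ν).inv = κ • ν.inv`.
[cite: Halmos1950, §60 Theorem C] -/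
theorem inv_nnreal_smul (κ : ℝ≥0) (ν : Measure G) : (κ • ν).inv = κ • ν.inv := by
  rw [← Measure.coe_nnreal_smul, ← Measure.coe_nnreal_smul, Measure.inv_def, Measure.inv_def,
    Measure.map_smul]

/-- **A right-invariant measure finite on compacts is a multiple of any two-sided Haar measure**, with a
NON-ZERO scalar when the measure is non-zero: `μ = κ • νi`, `κ ≠ 0` (`μ.inv`, `νi.inv` are left
invariant, hence multiples of `νi` by uniqueness; invert back). [cite: Folland1999, Thm 11.9]
[cite: Halmos1950, §60 Theorem C] -/
theorem exists_nnreal_smul_eq_of_isMulRightInvariant_of_ne_zero (νi : Measure G) [νi.IsHaarMeasure]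
    [νi.IsMulRightInvariant] (μ : Measure G) [IsFiniteMeasureOnCompacts μ] [μ.IsMulRightInvariant]
    (hμ : μ ≠ 0) : ∃ κ : ℝ≥0, κ ≠ 0 ∧ μ = κ • νi := by
  -- `μ.inv = c₁ • νi` and `νi.inv = c₀ • νi` (left invariance of the inverted measures + uniqueness)
  have h1 : μ.inv = haarScalarFactor μ.inv νi • νi := isMulLeftInvariant_eq_smul μ.inv νi
  have h0 : νi.inv = haarScalarFactor νi.inv νi • νi := isMulLeftInvariant_eq_smul νi.inv νi
  set c₁ : ℝ≥0 := haarScalarFactor μ.inv νi with hc₁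
  set c₀ : ℝ≥0 := haarScalarFactor νi.inv νi with hc₀
  -- invert back: `μ = (c₁ • νi).inv = c₁ • νi.inv = (c₁ c₀) • νi`
  have hμeq : μ = (c₁ * c₀) • νi := by
    calc μ = μ.inv.inv := (Measure.inv_inv μ).symm
      _ = (c₁ • νi).inv := by rw [h1]
      _ = c₁ • νi.inv := inv_nnreal_smul c₁ νi
      _ = c₁ • (c₀ • νi) := by rw [← h0]
      _ = (c₁ * c₀) • νi := smul_smul c₁ c₀ νi
  refine ⟨c₁ * c₀, ?_, hμeq⟩
  intro hκ
  apply hμ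
  rw [hμeq, hκ, zero_smul]

/-- **RIGHT-INVARIANT, FINITE ON COMPACTS, NON-ZERO ⇒ HAAR** on a group carrying a two-sided Haar measure
`νi`: `μ = κ • νi` with `κ ≠ 0` is left invariant, finite on compacts and positive on opens (Mathlib
`IsHaarMeasure.smul`). [cite: Folland1999, Thm 11.9] [cite: Halmos1950, §60 Theorem C] -/
theorem isHaarMeasure_of_isMulRightInvariant_of_ne_zero (νi : Measure G) [νi.IsHaarMeasure]
    [νi.IsMulRightInvariant] (μ : Measure G) [IsFiniteMeasureOnCompacts μ] [μ.IsMulRightInvariant]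
    (hμ : μ ≠ 0) : μ.IsHaarMeasure := by
  obtain ⟨κ, hκ, h⟩ := exists_nnreal_smul_eq_of_isMulRightInvariant_of_ne_zero νi μ hμ
  rw [h]
  exact IsHaarMeasure.nnreal_smul νi hκ

/-- Under the same hypotheses `μ` is also LEFT invariant (the group is unimodular as witnessed by `νi`).
[cite: Folland1999, Thm 11.9] -/
theorem isMulLeftInvariant_of_isMulRightInvariant_of_ne_zero (νi : Measure G) [νi.IsHaarMeasure]
    [νi.IsMulRightInvariant] (μ : Measure G) [IsFiniteMeasureOnCompacts μ] [μ.IsMulRightInvariant]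
    (hμ : μ ≠ 0) : μ.IsMulLeftInvariant :=
  (isHaarMeasure_of_isMulRightInvariant_of_ne_zero νi μ hμ).toIsMulLeftInvariant

/-- The zero measure aside, right invariance alone already gives `μ = κ • νi` for SOME `κ : ℝ≥0`
(possibly `0`). [cite: Folland1999, Thm 11.9] -/
theorem exists_nnreal_smul_eq_of_isMulRightInvariant (νi : Measure G) [νi.IsHaarMeasure]
    [νi.IsMulRightInvariant] (μ : Measure G) [IsFiniteMeasureOnCompacts μ] [μ.IsMulRightInvariant] :
    ∃ κ : ℝ≥0, μ = κ • νi := by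
  by_cases hμ : μ = 0
  · exact ⟨0, by rw [hμ, zero_smul]⟩
  · obtain ⟨κ, -, h⟩ := exists_nnreal_smul_eq_of_isMulRightInvariant_of_ne_zero νi μ hμ
    exact ⟨κ, h⟩

end Literature.MeasureTheory.Group
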